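import Summits.HubbardSuperconductivity.HubbardSuperconductivity.Theorems.NodalWardXYVisonPairCostDefs
import Literature.MathematicalPhysics.QuantumLattice.BdGBondHamiltonianFreeEnergyBounds
import Literature.MathematicalPhysics.QuantumLattice.BdGBondHamiltonianTorus
import Summits.HubbardSuperconductivity.HubbardSuperconductivity.Theorems.VisonPairCost.Negative.GaugeStructure

/-!
# BdG ground-energy formula: crux `VisonPairCost` (stmt-HubbardSuperconductivity-1266),
# line `Sketch`, stub `stub_groundEnergyFormula`

The registered stub `GroundEnergyFormula` of `Theorems/NodalWardXYVisonPairCostDefs.lean`: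
for `L ≥ 4` and all `μ, Δ₀, R`,
`E₀(visonH L μ Δ₀ R) = −μ L² − ½ Σᵢ |λᵢ(visonNambu L μ Δ₀ R)|`,
the BCS / Lieb partial particle–hole ground-energy formula for the crux's vison-string `d`-wave
BdG Hamiltonian, the eigenvalues being those of its one-body Nambu matrix
`visonNambu = bdgNambuMatrix (visonHop L R) (visonPair L Δ₀ R) μ`.

The tree proves the formula for the general lattice BdG Hamiltonian with bond data on ordered
site pairs, `groundEnergy_bdgBondHamiltonian` (`BdGBondHamiltonianFreeEnergyBounds`):
`E₀(bdgBondHamiltonian τ Δ μ) = Σ_x (Re τ(x,x) − μ) − ½ Σᵢ |λᵢ(bdgNambuMatrix τ Δ μ)|` for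
Hermitian `τ`. This file supplies the bridge and the bookkeeping:

* `bdgTorus_eq_bdgBondHamiltonian` — the torus BdG Hamiltonian with directed-bond data `(τ, Δ)`
  (`BdGBondHamiltonianTorus`) is `bdgBondHamiltonian τ' Δ'` for the data spread on ordered site
  pairs of the fermionic torus, `τ'(u,v) = Σᵢ ([v = u + eᵢ] τ(u,i) + [u = v + eᵢ] conj τ(v,i))`,
  `Δ'(u,v) = Σᵢ [v = u + eᵢ] Δ(u,i)` (sums over the fermionic torus are sums over `(ℤ/Lℤ)²`,
  `FermionTorus.sum_eq_sum_torusSite`, and the indicators collapse the inner sums);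
* `visonH_eq_bdgBondHamiltonian` —
  `visonH L μ Δ₀ R = bdgBondHamiltonian (visonHop L R) (visonPair L Δ₀ R) μ` (`visonH` is
  literally the left-hand side of `Negative.cruxHamiltonian_eq_bdgTorus`, a `bdgTorus` with the
  real bond data `−s_R`, `s_R Δ₀ g`);
* `star_visonHop` (Hermiticity of the spread hopping) and `visonHop_self` (no site is its own
  neighbour for `L ≥ 2`, so the diagonal `τ'(x,x)` vanishes), whence, with `|Λ| = L²`,
  `Σ_x (Re τ'(x,x) − μ) = −μ L²`.

Sources: P. G. de Gennes, *Superconductivity of Metals and Alloys* (1966), §5-3 eq. (5-45);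
V. Bach, E. H. Lieb, J. P. Solovej, J. Stat. Phys. 76 (1994) 3, Theorem 2.3 (the quasi-free
ground energy); O. Vafek, A. Melikyan, M. Franz, Z. Tešanović, PRB 63 (2001) 134509, App. A (A1)
(bond data of the lattice `d`-wave BdG Hamiltonian). Tree facts used:
`groundEnergy_bdgBondHamiltonian`, `isHermitian_bdgNambuMatrix`,
`Negative.cruxHamiltonian_eq_bdgTorus`, `bdgTorus_eq`, `bdgBondHamiltonian_eq`, `bdgHopping_eq`,
`bdgPairing_eq`, `torusBondHop_conjTranspose`, `FermionTorus.sum_eq_sum_torusSite`.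
-/

noncomputable section

-- tree namespace Summit.HubbardSuperconductivity.HubbardSuperconductivity (D-0017)
set_option linter.dupNamespace false

namespace Summit.HubbardSuperconductivity.HubbardSuperconductivity.Theorems.VisonPairCost

open Matrix Finset Literature.Probability.LatticeModels Literature.MathematicalPhysics.QuantumLattice
open Summit.HubbardSuperconductivity.HubbardSuperconductivity.Theses.NodalWardXY
open scoped ComplexConjugate

/-! ### Bookkeeping -/

/-- Casting a real `if-then-else` into `ℂ`. -/
theorem ofReal_ite (P : Prop) [Decidable P] (a b : ℝ) :
    ((if P then a else b : ℝ) : ℂ) = if P then (a : ℂ) else (b : ℂ) := by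
  split_ifs <;> rfl

variable (L : ℕ) [NeZero L]

/-! ### The bridge `bdgTorus = bdgBondHamiltonian` (bond data spread on ordered site pairs) -/

/-- Inner bookkeeping: a triple sum whose outer index is pinned to `x + eᵢ` by an indicator collapses,
`Σ_y Σ_σ Σ_i [y = x + eᵢ] F(y,σ,i) = Σ_σ Σ_i F(x + eᵢ, σ, i)`. -/
theorem sum_sum_sum_ite_eq_add_single {M : Type*} [AddCommMonoid M] (x : TorusSite 2 L)
    (F : TorusSite 2 L → Fin 2 → Fin 2 → M) :
    (∑ y : TorusSite 2 L, ∑ σ : Fin 2, ∑ i : Fin 2, if y = x + Pi.single i 1 then F y σ i else 0) =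
      ∑ σ : Fin 2, ∑ i : Fin 2, F (x + Pi.single i 1) σ i := by
  conv_lhs => rw [Finset.sum_comm]
  refine Finset.sum_congr rfl fun σ _ => ?_
  rw [Finset.sum_comm]
  simp only [Finset.sum_ite_eq', Finset.mem_univ, if_true]

/-- The forward-bond indicator part of the spread hopping data reproduces the directed-bond hopping
`Σ_{x,i,σ} τ(x,i) c†_{xσ} c_{x+eᵢ,σ}`. -/
theorem sum_ite_forward_smul_hop (τ : TorusSite 2 L → Fin 2 → ℂ) :
    (∑ u : FermionTorus 2 L, ∑ v : FermionTorus 2 L, ∑ σ : Fin 2, ∑ i : Fin 2,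
        (if v.toTorusSite = u.toTorusSite + Pi.single i 1 then τ u.toTorusSite i else 0) •
          (creation (orb u σ) * annihilation (orb v σ))) =
      ∑ x : TorusSite 2 L, ∑ i : Fin 2, ∑ σ : Fin 2, τ x i • torusBondHop L x i σ := by
  rw [FermionTorus.sum_eq_sum_torusSite]
  refine Finset.sum_congr rfl fun x _ => ?_
  rw [FermionTorus.sum_eq_sum_torusSite]
  simp only [FermionTorus.toTorusSite_ofTorusSite, ite_smul, zero_smul]
  rw [sum_sum_sum_ite_eq_add_single, Finset.sum_comm]
  rfl

/-- The backward-bond indicator part of the spread hopping data reproduces the adjoint hopping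
`Σ_{x,i,σ} conj τ(x,i) c†_{x+eᵢ,σ} c_{xσ}`. -/
theorem sum_ite_backward_smul_hop (τ : TorusSite 2 L → Fin 2 → ℂ) :
    (∑ u : FermionTorus 2 L, ∑ v : FermionTorus 2 L, ∑ σ : Fin 2, ∑ i : Fin 2,
        (if u.toTorusSite = v.toTorusSite + Pi.single i 1 then star (τ v.toTorusSite i) else 0) •
          (creation (orb u σ) * annihilation (orb v σ))) =
      ∑ x : TorusSite 2 L, ∑ i : Fin 2, ∑ σ : Fin 2, (τ x i • torusBondHop L x i σ)ᴴ := by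
  rw [Finset.sum_comm, FermionTorus.sum_eq_sum_torusSite]
  refine Finset.sum_congr rfl fun x _ => ?_
  rw [FermionTorus.sum_eq_sum_torusSite]
  simp only [FermionTorus.toTorusSite_ofTorusSite, ite_smul, zero_smul]
  rw [sum_sum_sum_ite_eq_add_single, Finset.sum_comm]
  simp only [conjTranspose_smul, torusBondHop_conjTranspose, Complex.star_def]

/-- The spread hopping data give the hopping part of `bdgTorus`:
`bdgHopping τ' = Σ_{x,i,σ} (τ(x,i) c†_{xσ}c_{x+eᵢ,σ} + h.c.)`. -/
theorem bdgHopping_spread (τ : TorusSite 2 L → Fin 2 → ℂ) :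
    bdgHopping (fun u v : FermionTorus 2 L => ∑ i : Fin 2,
        ((if v.toTorusSite = u.toTorusSite + Pi.single i 1 then τ u.toTorusSite i else 0) +
          (if u.toTorusSite = v.toTorusSite + Pi.single i 1 then star (τ v.toTorusSite i) else 0))) =
      ∑ x : TorusSite 2 L, ∑ i : Fin 2, ∑ σ : Fin 2,
        (τ x i • torusBondHop L x i σ + (τ x i • torusBondHop L x i σ)ᴴ) := by
  simp only [bdgHopping_eq, Finset.sum_smul, add_smul, Finset.sum_add_distrib]
  rw [sum_ite_forward_smul_hop, sum_ite_backward_smul_hop]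

/-- The spread pairing data give the pairing field of `bdgTorus`:
`bdgPairing Δ' = Σ_{x,i} Δ(x,i) b_{x,i}`. -/
theorem bdgPairing_spread (Δ : TorusSite 2 L → Fin 2 → ℂ) :
    bdgPairing (fun u v : FermionTorus 2 L => ∑ i : Fin 2,
        (if v.toTorusSite = u.toTorusSite + Pi.single i 1 then Δ u.toTorusSite i else 0)) =
      ∑ x : TorusSite 2 L, ∑ i : Fin 2, Δ x i • torusBondPair L x i := by
  rw [bdgPairing_eq, FermionTorus.sum_eq_sum_torusSite]
  refine Finset.sum_congr rfl fun x _ => ?_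
  rw [FermionTorus.sum_eq_sum_torusSite]
  simp only [FermionTorus.toTorusSite_ofTorusSite, Finset.sum_smul, ite_smul, zero_smul]
  rw [Finset.sum_comm]
  simp only [Finset.sum_ite_eq', Finset.mem_univ, if_true]
  rfl

/-- **The bridge**: the torus BdG Hamiltonian with directed-bond data `(τ, Δ)` is the general
`bdgBondHamiltonian` of the bond data spread on ordered site pairs of the fermionic torus,
`τ'(u,v) = Σᵢ ([v = u + eᵢ] τ(u,i) + [u = v + eᵢ] conj τ(v,i))`, `Δ'(u,v) = Σᵢ [v = u + eᵢ] Δ(u,i)`. -/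
theorem bdgTorus_eq_bdgBondHamiltonian (τ Δ : TorusSite 2 L → Fin 2 → ℂ) (μ : ℝ) :
    bdgTorus L τ Δ μ =
      bdgBondHamiltonian
        (fun u v : FermionTorus 2 L => ∑ i : Fin 2,
          ((if v.toTorusSite = u.toTorusSite + Pi.single i 1 then τ u.toTorusSite i else 0) +
            (if u.toTorusSite = v.toTorusSite + Pi.single i 1 then star (τ v.toTorusSite i) else 0)))
        (fun u v : FermionTorus 2 L => ∑ i : Fin 2,
          (if v.toTorusSite = u.toTorusSite + Pi.single i 1 then Δ u.toTorusSite i else 0)) μ := by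
  rw [bdgBondHamiltonian_eq, bdgHopping_spread, bdgPairing_spread, bdgTorus_eq]
  congr 1
  simp only [Finset.sum_add_distrib, conjTranspose_sum]

/-! ### The vison Hamiltonian as a `bdgBondHamiltonian` -/

/-- The spread hopping data of `visonH` are Hermitian: `conj (visonHop u v) = visonHop v u`. -/
theorem star_visonHop (R : ℕ) (u v : FermionTorus 2 L) :
    star (visonHop L R u v) = visonHop L R v u := by
  unfold visonHop
  rw [Complex.star_def, Complex.conj_ofReal]
  congr 1
  exact Finset.sum_congr rfl fun i _ => add_comm _ _

/-- `visonH L μ Δ₀ R = bdgBondHamiltonian (visonHop L R) (visonPair L Δ₀ R) μ`: the crux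
Hamiltonian is the general lattice BdG Hamiltonian of its spread bond data. -/
theorem visonH_eq_bdgBondHamiltonian (μ Δ₀ : ℝ) (R : ℕ) :
    visonH L μ Δ₀ R = bdgBondHamiltonian (visonHop L R) (visonPair L Δ₀ R) μ := by
  unfold visonH
  dsimp only
  rw [Negative.cruxHamiltonian_eq_bdgTorus, bdgTorus_eq_bdgBondHamiltonian]
  congr 1
  · funext u v
    simp only [Complex.star_def, Complex.conj_ofReal, visonHop, sgn]
    simp only [Complex.ofReal_sum, Complex.ofReal_add, ofReal_ite, Complex.ofReal_neg,
      Complex.ofReal_one, Complex.ofReal_zero]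
  · funext u v
    simp only [visonPair, sgn, Complex.ofReal_sum, ofReal_ite, Complex.ofReal_mul,
      Complex.ofReal_neg, Complex.ofReal_one, Complex.ofReal_zero]

/-! ### The formula -/

/-- The diagonal of the spread hopping data vanishes for `L ≥ 2` (no site is its own neighbour). -/
theorem visonHop_self (hL : 2 ≤ L) (R : ℕ) (u : FermionTorus 2 L) : visonHop L R u u = 0 := by
  haveI : Fact (1 < L) := ⟨hL⟩
  have h : ∀ i : Fin 2, u.toTorusSite ≠ u.toTorusSite + Pi.single i 1 := fun i h => by
    have h1 : (Pi.single i (1 : ZMod L) : TorusSite 2 L) = 0 := by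
      simpa using h.symm
    exact one_ne_zero (Pi.single_eq_zero_iff.1 h1)
  unfold visonHop
  simp only [h, if_false, add_zero, Finset.sum_const_zero, Complex.ofReal_zero]

/-- **Stub `stub_groundEnergyFormula`** of line `Sketch`: the BdG ground-energy formula
`E₀(visonH R) = −μL² − ½ Σᵢ |λᵢ(visonNambu R)|` for `L ≥ 4` (tree `groundEnergy_bdgBondHamiltonian`
through the bridge `visonH_eq_bdgBondHamiltonian`; the Hermiticity witness is
`isHermitian_bdgNambuMatrix`). -/
theorem stub_groundEnergyFormula : GroundEnergyFormula := by
  intro L _ hL μ Δ₀ R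
  have hτ : ∀ x y, star (visonHop L R x y) = visonHop L R y x := star_visonHop L R
  refine ⟨isHermitian_bdgNambuMatrix hτ (visonPair L Δ₀ R) μ, ?_⟩
  have key := groundEnergy_bdgBondHamiltonian hτ (visonPair L Δ₀ R) μ
  rw [← visonH_eq_bdgBondHamiltonian] at key
  have hcard : Fintype.card (FermionTorus 2 L) = L ^ 2 := by simp [FermionTorus, Fintype.card_lex]
  have hdiag : ∑ x : FermionTorus 2 L, ((visonHop L R x x).re - μ) = -μ * (L : ℝ) ^ 2 := by
    simp only [visonHop_self L (by omega) R, Complex.zero_re, zero_sub, Finset.sum_const,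
      Finset.card_univ, hcard, smul_neg, nsmul_eq_mul]
    push_cast
    ring
  rw [hdiag] at key
  -- `convert`, not `exact`: the `DecidableEq` instance paths on `Orb (FermionTorus 2 L)` of the
  -- registered statement and of the generic tree lemma differ (equal by `Subsingleton`, but
  -- expensive for the kernel to unfold).
  convert key using 6
  rfl

end Summit.HubbardSuperconductivity.HubbardSuperconductivity.Theorems.VisonPairCost

end
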